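import Literature.Analysis.FluidPDE.PlanarMoveCover
import Literature.Analysis.FluidPDE.SmoothRampProfiles
import HarnessLib

/-!
# Chain cut-offs: region data from box plateaus and moving junction steps

Topic `Literature/Analysis/FluidPDE`. Eighth file of the explicit pullback calculus for the planar
transport equation. `PlanarMoveCover.lean` derives transport, the bound and the vanishing clauses
of an assembled explicit move from REGION DATA (`IsRegionData`: open cores and junctions with
cut-off identities, closed tubes, a cover). This file produces the cut-off part of such data from
the concrete shape used by every rectilinear design — a **chain**: element `k < K` carries

* a STATIC box plateau `τ_k(z) = plateau(a₀,b₀,ρ)(z₀) · plateau(a₁,b₁,ρ)(z₁)` (`BoxPlateau`,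
  `SmoothRampProfiles.plateau`), equal to `1` on the inner box and supported in the outer box;
* the junction steps `σ_j(t,z) = step (s_j (z_{i_j} - a_j(t)) / ℓ_j)` (`JStep`) between elements
  `j` and `j+1`, with a MOVING breakpoint `a_j(t)`; element `k` is entered through `σ_{k-1}`
  (`σ_{-1} := 1`) and left through `σ_k` (`σ_{K-1} := 0`);

and the cut-off of element `k` is `χ_k = τ_k · (σ_{k-1} - σ_k)` (`chainChi`). Under two checkable
conditions — the ORDER condition (inside the box of element `k`, junction `k-1` is crossed before
junction `k`: `σ_k > 0 ⇒ σ_{k-1} = 1`) and DISJOINTNESS of the boxes of non-consecutive elements —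
the cut-offs telescope, and the identities of `IsRegionData` hold on explicit open regions:
`χ_k = 1`, all others `0` on `Core k`; `χ_k + χ_{k+1} = 1`, all others `0` on the junction region;
`χ_k ≠ 0` only on the closed region `TubeBox k` (`chainChi_ne_zero`). The main theorem
`isRegionData_chain` assembles `IsRegionData` from a chain, an open agreement region per junction
(where the two consecutive elements coincide — supplied by the element files) and a closed band
per element containing the support of its scalar, leaving the cover as the one geometric
hypothesis (per element, linear in the data) to be checked on the design.

Folklore; no named facts. Infrastructure towards a discharge of `acm_compatible_blocks`
(`QuasiSelfSimilarCompatibleBlocks.lean`).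

## References

* G. Alberti, G. Crippa, A. L. Mazzucato, *Exponential self-similar mixing by incompressible
  flows*, J. Amer. Math. Soc. 32 (2019), 445–490, §§7–8 (arXiv:1605.02090).
-/

noncomputable section

open Function Set Filter
open scoped Topology ContDiff

namespace Literature.Analysis.FluidPDE

namespace PlanarKinematics

open Gluing

/-- The plane `ℝ²` as a Euclidean space. [folklore] -/
local notation "E²" => EuclideanSpace ℝ (Fin 2)

/-! ## Box plateaus -/

/-- **Box plateau data**: the outer box `[a₀,b₀] × [a₁,b₁]` and the transition length `ρ`.
[folklore] -/
structure BoxPlateau where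
  /-- left end, axis `0` -/
  a₀ : ℝ
  /-- right end, axis `0` -/
  b₀ : ℝ
  /-- lower end, axis `1` -/
  a₁ : ℝ
  /-- upper end, axis `1` -/
  b₁ : ℝ
  /-- transition length -/
  ρ : ℝ

namespace BoxPlateau

/-- The plateau function of a box: product of two one-dimensional plateaus. [folklore] -/
def val (B : BoxPlateau) (z : E²) : ℝ := plateau B.a₀ B.b₀ B.ρ (z 0) * plateau B.a₁ B.b₁ B.ρ (z 1)

/-- The open INNER box, where the plateau is `1` (with margin: strict inequalities at
`a + 2ρ/3`, `b - 2ρ/3`). [folklore] -/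
def inner (B : BoxPlateau) : Set E² :=
  {z | B.a₀ + 2 * B.ρ / 3 < z 0 ∧ z 0 < B.b₀ - 2 * B.ρ / 3 ∧ B.a₁ + 2 * B.ρ / 3 < z 1 ∧ z 1 < B.b₁ - 2 * B.ρ / 3}

/-- The closed SUPPORT box `[a₀ + ρ/3, b₀ - ρ/3] × [a₁ + ρ/3, b₁ - ρ/3]`, outside which the plateau
vanishes. [folklore] -/
def supp (B : BoxPlateau) : Set E² :=
  {z | B.a₀ + B.ρ / 3 ≤ z 0 ∧ z 0 ≤ B.b₀ - B.ρ / 3 ∧ B.a₁ + B.ρ / 3 ≤ z 1 ∧ z 1 ≤ B.b₁ - B.ρ / 3}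

/-- Unfolding the box plateau. [folklore] -/
theorem val_apply (B : BoxPlateau) (z : E²) :
    B.val z = plateau B.a₀ B.b₀ B.ρ (z 0) * plateau B.a₁ B.b₁ B.ρ (z 1) := rfl

/-- The box plateau takes values in `[0,1]`. [folklore] -/
theorem val_mem_Icc (B : BoxPlateau) (z : E²) : B.val z ∈ Icc (0 : ℝ) 1 := by
  obtain ⟨h0, h0'⟩ := plateau_mem_Icc B.a₀ B.b₀ B.ρ (z 0)
  obtain ⟨h1, h1'⟩ := plateau_mem_Icc B.a₁ B.b₁ B.ρ (z 1)
  exact ⟨mul_nonneg h0 h1, mul_le_one₀ h0' h1 h1'⟩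

/-- **The box plateau is `1` on the inner box.** [folklore] -/
theorem val_eq_one (B : BoxPlateau) (hρ : 0 < B.ρ) {z : E²} (hz : z ∈ B.inner) : B.val z = 1 := by
  obtain ⟨h1, h2, h3, h4⟩ := hz
  rw [val_apply, plateau_of_mem hρ h1.le h2.le, plateau_of_mem hρ h3.le h4.le, mul_one]

/-- **The box plateau vanishes off the support box.** [folklore] -/
theorem val_eq_zero (B : BoxPlateau) (hρ : 0 < B.ρ) {z : E²} (hz : z ∉ B.supp) : B.val z = 0 := by
  simp only [supp, mem_setOf_eq, not_and_or, not_le] at hz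
  rw [val_apply]
  rcases hz with h | h | h | h
  · rw [plateau_of_le_left hρ h.le, zero_mul]
  · rw [plateau_of_ge_right hρ h.le, zero_mul]
  · rw [plateau_of_le_left hρ h.le, mul_zero]
  · rw [plateau_of_ge_right hρ h.le, mul_zero]

/-- If the box plateau does not vanish, the point is in the support box. [folklore] -/
theorem mem_supp_of_val_ne_zero (B : BoxPlateau) (hρ : 0 < B.ρ) {z : E²} (hz : B.val z ≠ 0) :
    z ∈ B.supp := by
  by_contra h
  exact hz (B.val_eq_zero hρ h)

/-- The inner box is open. [folklore] -/
theorem isOpen_inner (B : BoxPlateau) : IsOpen B.inner := isOpen_box _ _ _ _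

/-- The support box is closed. [folklore] -/
theorem isClosed_supp (B : BoxPlateau) : IsClosed B.supp := isClosed_box _ _ _ _

/-- The box plateau is smooth. [folklore] -/
theorem contDiff_val (B : BoxPlateau) {n : ℕ∞} : ContDiff ℝ n B.val :=
  (plateau_contDiff.comp (contDiff_coord 0)).mul (plateau_contDiff.comp (contDiff_coord 1))

end BoxPlateau

/-! ## Moving junction steps -/

/-- **Junction step data**: the axis `i`, the orientation `s` (`±1` in practice), the moving
breakpoint `a(t)` and the transition length `ℓ`. [folklore] -/
structure JStep where
  /-- coordinate axis along which the step is taken -/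
  axis : Fin 2
  /-- orientation -/
  sgn : ℝ
  /-- moving breakpoint -/
  pos : ℝ → ℝ
  /-- transition length -/
  len : ℝ

namespace JStep

/-- The argument `s (z_i - a(t)) / ℓ` of a junction step. [folklore] -/
def arg (J : JStep) (t : ℝ) (z : E²) : ℝ := J.sgn * (z J.axis - J.pos t) / J.len

/-- The value `step (s (z_i - a(t)) / ℓ)` of a junction step. [folklore] -/
def val (J : JStep) (t : ℝ) (z : E²) : ℝ := step (J.arg t z)

/-- Unfolding the value. [folklore] -/
theorem val_apply (J : JStep) (t : ℝ) (z : E²) : J.val t z = step (J.sgn * (z J.axis - J.pos t) / J.len) := rfl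

/-- A junction step takes values in `[0,1]`. [folklore] -/
theorem val_mem_Icc (J : JStep) (t : ℝ) (z : E²) : J.val t z ∈ Icc (0 : ℝ) 1 := step_mem_Icc _

/-- The step is `0` where the argument is `≤ 1/3`. [folklore] -/
theorem val_eq_zero (J : JStep) {t : ℝ} {z : E²} (h : J.arg t z ≤ 1 / 3) : J.val t z = 0 := step_of_le h

/-- The step is `1` where the argument is `≥ 2/3`. [folklore] -/
theorem val_eq_one (J : JStep) {t : ℝ} {z : E²} (h : 2 / 3 ≤ J.arg t z) : J.val t z = 1 := step_of_ge h

/-- If the step is positive, the argument exceeds `1/3`. [folklore] -/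
theorem arg_gt_of_val_pos (J : JStep) {t : ℝ} {z : E²} (h : 0 < J.val t z) : 1 / 3 < J.arg t z := by
  by_contra h'
  rw [not_lt] at h'
  exact h.ne' (J.val_eq_zero h')

/-- If the step is less than `1`, the argument is below `2/3`. [folklore] -/
theorem arg_lt_of_val_lt_one (J : JStep) {t : ℝ} {z : E²} (h : J.val t z < 1) : J.arg t z < 2 / 3 := by
  by_contra h'
  rw [not_lt] at h'
  exact h.ne (J.val_eq_one h')

/-- The argument is continuous in `(t, z)` when the breakpoint is continuous. [folklore] -/
theorem continuous_uncurry_arg (J : JStep) (hpos : Continuous J.pos) : Continuous (uncurry J.arg) := by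
  have hc : Continuous fun p : ℝ × E² => p.2 J.axis := (EuclideanSpace.proj J.axis).continuous.comp continuous_snd
  exact ((continuous_const.mul (hc.sub (hpos.comp continuous_fst))).div_const _ :)

/-- The step is smooth in `(t, z)` when the breakpoint is smooth. [folklore] -/
theorem contDiff_uncurry_val (J : JStep) (hpos : ContDiff ℝ ∞ J.pos) : ContDiff ℝ ∞ (uncurry J.val) := by
  have hc : ContDiff ℝ ∞ fun p : ℝ × E² => p.2 J.axis := (contDiff_coord J.axis).comp contDiff_snd
  have harg : ContDiff ℝ ∞ (uncurry J.arg) :=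
    (contDiff_const.mul (hc.sub (hpos.comp contDiff_fst))).div_const _
  exact step_contDiff.comp harg

/-- The region `{arg > c}` is open in space-time. [folklore] -/
theorem isOpen_arg_gt (J : JStep) (hpos : Continuous J.pos) (c : ℝ) : IsOpen {p : ℝ × E² | c < J.arg p.1 p.2} :=
  isOpen_lt continuous_const (J.continuous_uncurry_arg hpos)

/-- The region `{arg < c}` is open in space-time. [folklore] -/
theorem isOpen_arg_lt (J : JStep) (hpos : Continuous J.pos) (c : ℝ) : IsOpen {p : ℝ × E² | J.arg p.1 p.2 < c} :=
  isOpen_lt (J.continuous_uncurry_arg hpos) continuous_const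

/-- The region `{c ≤ arg}` is closed in space-time. [folklore] -/
theorem isClosed_arg_ge (J : JStep) (hpos : Continuous J.pos) (c : ℝ) : IsClosed {p : ℝ × E² | c ≤ J.arg p.1 p.2} :=
  isClosed_le continuous_const (J.continuous_uncurry_arg hpos)

/-- The region `{arg ≤ c}` is closed in space-time. [folklore] -/
theorem isClosed_arg_le (J : JStep) (hpos : Continuous J.pos) (c : ℝ) : IsClosed {p : ℝ × E² | J.arg p.1 p.2 ≤ c} :=
  isClosed_le (J.continuous_uncurry_arg hpos) continuous_const

end JStep

/-! ## Chains and their cut-offs -/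

/-- **Chain data**: box plateaus `B k` of the elements and junction steps `J j` between
consecutive elements (only indices `k < K`, `j + 1 < K` matter). [folklore] -/
structure ChainData where
  /-- number of elements -/
  K : ℕ
  /-- box plateau of element `k` -/
  B : ℕ → BoxPlateau
  /-- junction step between elements `j` and `j + 1` -/
  J : ℕ → JStep

namespace ChainData

variable (C : ChainData)

/-- The out-step of element `k`: the junction step `σ_k`, or `0` for the last element. [folklore] -/
def sigmaOut (k : ℕ) (t : ℝ) (z : E²) : ℝ := if k + 1 < C.K then (C.J k).val t z else 0

/-- The in-step of element `k`: `σ_{k-1}`, or `1` for the first element. [folklore] -/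
def sigmaIn (k : ℕ) (t : ℝ) (z : E²) : ℝ := if k = 0 then 1 else C.sigmaOut (k - 1) t z

/-- **The chain cut-off** `χ_k(t, z) = τ_k(z) (σ_{k-1}(t,z) - σ_k(t,z))`. [folklore] -/
def chi (k : ℕ) (t : ℝ) (z : E²) : ℝ := (C.B k).val z * (C.sigmaIn k t z - C.sigmaOut k t z)

/-- Unfolding the chain cut-off. [folklore] -/
theorem chi_apply (k : ℕ) (t : ℝ) (z : E²) :
    C.chi k t z = (C.B k).val z * (C.sigmaIn k t z - C.sigmaOut k t z) := rfl

/-- The in-step of element `k + 1` is the out-step of element `k`. [folklore] -/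
theorem sigmaIn_succ (k : ℕ) : C.sigmaIn (k + 1) = C.sigmaOut k := by
  funext t z; simp [sigmaIn]

/-- The in-step of element `0` is `1`. [folklore] -/
theorem sigmaIn_zero : C.sigmaIn 0 = fun _ _ => 1 := by
  funext t z; simp [sigmaIn]

/-- Out-steps take values in `[0,1]`. [folklore] -/
theorem sigmaOut_mem_Icc (k : ℕ) (t : ℝ) (z : E²) : C.sigmaOut k t z ∈ Icc (0 : ℝ) 1 := by
  unfold sigmaOut; split_ifs
  · exact (C.J k).val_mem_Icc t z
  · exact ⟨le_rfl, zero_le_one⟩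

/-- In-steps take values in `[0,1]`. [folklore] -/
theorem sigmaIn_mem_Icc (k : ℕ) (t : ℝ) (z : E²) : C.sigmaIn k t z ∈ Icc (0 : ℝ) 1 := by
  unfold sigmaIn; split_ifs
  · exact ⟨zero_le_one, le_rfl⟩
  · exact C.sigmaOut_mem_Icc _ t z

/-- **Well-formedness of a chain**: positive transition lengths, smooth breakpoints, the ORDER
condition (inside the support box of element `k`, a positive out-step forces the in-step to be
`1`) and DISJOINTNESS of the support boxes of non-consecutive elements. [folklore] -/
structure WF : Prop where
  /-- plateau transition lengths are positive -/
  ρ_pos : ∀ k < C.K, 0 < (C.B k).ρ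
  /-- breakpoints are smooth -/
  pos_smooth : ∀ j, j + 1 < C.K → ContDiff ℝ ∞ (C.J j).pos
  /-- order: in the box of `k`, `σ_k > 0 ⇒ σ_{k-1} = 1` -/
  order : ∀ k < C.K, ∀ (t : ℝ) (z : E²), z ∈ (C.B k).supp → 0 < C.sigmaOut k t z → C.sigmaIn k t z = 1
  /-- boxes of non-consecutive elements are disjoint -/
  disjoint : ∀ j < C.K, ∀ k < C.K, j + 2 ≤ k → ∀ z : E², z ∈ (C.B j).supp → z ∉ (C.B k).supp

variable {C}

/-- Breakpoints are continuous. [folklore] -/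
theorem WF.pos_continuous (h : C.WF) {j : ℕ} (hj : j + 1 < C.K) : Continuous (C.J j).pos :=
  (h.pos_smooth j hj).continuous

/-- **The chain cut-offs are smooth.** [folklore] -/
theorem WF.contDiff_uncurry_chi (h : C.WF) (k : ℕ) : ContDiff ℝ ∞ (uncurry (C.chi k)) := by
  have hτ : ContDiff ℝ ∞ fun p : ℝ × E² => (C.B k).val p.2 := (C.B k).contDiff_val.comp contDiff_snd
  have hout : ∀ m, ContDiff ℝ ∞ (uncurry (C.sigmaOut m)) := by
    intro m
    unfold sigmaOut
    split_ifs with hm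
    · exact (C.J m).contDiff_uncurry_val (h.pos_smooth m hm)
    · exact contDiff_const
  have hin : ContDiff ℝ ∞ (uncurry (C.sigmaIn k)) := by
    unfold sigmaIn
    split_ifs
    · exact contDiff_const
    · exact hout _
  have e : uncurry (C.chi k) = fun p : ℝ × E² =>
      (C.B k).val p.2 * (uncurry (C.sigmaIn k) p - uncurry (C.sigmaOut k) p) := by
    funext p; rfl
  rw [e]
  exact hτ.mul (hin.sub (hout k))

/-- A cut-off outside its support box vanishes. [folklore] -/
theorem WF.chi_eq_zero_of_not_mem (h : C.WF) {k : ℕ} (hk : k < C.K) {t : ℝ} {z : E²}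
    (hz : z ∉ (C.B k).supp) : C.chi k t z = 0 := by
  rw [chi_apply, (C.B k).val_eq_zero (h.ρ_pos k hk) hz, zero_mul]

/-- **Consequence of the order condition, forward**: in the box of `k + 1`, if `σ_k = 0` then
`χ_{k+1} = 0`. [folklore] -/
theorem WF.chi_succ_eq_zero (h : C.WF) {k : ℕ} (hk : k + 1 < C.K) {t : ℝ} {z : E²}
    (h0 : C.sigmaOut k t z = 0) : C.chi (k + 1) t z = 0 := by
  rw [chi_apply, sigmaIn_succ, h0]
  by_cases hz : z ∈ (C.B (k + 1)).supp
  · -- order at `k+1`: a positive out-step would force `σ_k = 1 ≠ 0`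
    have hle : C.sigmaOut (k + 1) t z ≤ 0 := by
      by_contra hpos
      rw [not_le] at hpos
      have := h.order (k + 1) hk t z hz hpos
      rw [sigmaIn_succ, h0] at this
      exact zero_ne_one this
    have hge : 0 ≤ C.sigmaOut (k + 1) t z := (C.sigmaOut_mem_Icc _ t z).1
    rw [le_antisymm hle hge, sub_zero, mul_zero]
  · rw [(C.B (k + 1)).val_eq_zero (h.ρ_pos _ hk) hz, zero_mul]

/-- **Consequence of the order condition, backward**: in the box of `k - 1` (here written for
`k`, about `χ_k` when its out-step is `1`): if `σ_k = 1` then `χ_k = 0`. [folklore] -/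
theorem WF.chi_eq_zero_of_sigmaOut_eq_one (h : C.WF) {k : ℕ} (hk : k < C.K) {t : ℝ} {z : E²}
    (h1 : C.sigmaOut k t z = 1) : C.chi k t z = 0 := by
  rw [chi_apply]
  by_cases hz : z ∈ (C.B k).supp
  · rw [h.order k hk t z hz (by rw [h1]; exact one_pos), h1, sub_self, mul_zero]
  · rw [(C.B k).val_eq_zero (h.ρ_pos _ hk) hz, zero_mul]

/-- **Core identities**: at a point of the inner box of `k` where the in-step is `1` and the
out-step is `0`, `χ_k = 1` and every other cut-off vanishes. [folklore] -/
theorem WF.chi_core (h : C.WF) {k : ℕ} (hk : k < C.K) {t : ℝ} {z : E²} (hz : z ∈ (C.B k).inner)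
    (hin : C.sigmaIn k t z = 1) (hout : C.sigmaOut k t z = 0) :
    C.chi k t z = 1 ∧ ∀ j < C.K, j ≠ k → C.chi j t z = 0 := by
  have hzs : z ∈ (C.B k).supp := by
    obtain ⟨h1, h2, h3, h4⟩ := hz
    have hρ := h.ρ_pos k hk
    exact ⟨by linarith, by linarith, by linarith, by linarith⟩
  refine ⟨by rw [chi_apply, (C.B k).val_eq_one (h.ρ_pos k hk) hz, hin, hout]; norm_num, fun j hj hjk => ?_⟩
  rcases Nat.lt_or_gt_of_ne hjk with hlt | hgt
  · by_cases hj1 : j + 1 = k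
    · -- `j = k - 1`: its out-step is the in-step of `k`, equal to `1`
      subst hj1
      rw [sigmaIn_succ] at hin
      exact h.chi_eq_zero_of_sigmaOut_eq_one hj hin
    · exact h.chi_eq_zero_of_not_mem hj fun hzj => h.disjoint j hj k hk (by omega) z hzj hzs
  · by_cases hj1 : k + 1 = j
    · subst hj1
      exact h.chi_succ_eq_zero hj hout
    · exact h.chi_eq_zero_of_not_mem hj fun hzj => h.disjoint k hk j hj (by omega) z hzs hzj

/-- **Junction identities**: at a point of the inner boxes of `k` and `k + 1` where the in-step of
`k` is `1` and the out-step of `k + 1` is `0`, `χ_k + χ_{k+1} = 1` and every other cut-off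
vanishes. [folklore] -/
theorem WF.chi_junction (h : C.WF) {k : ℕ} (hk : k + 1 < C.K) {t : ℝ} {z : E²}
    (hz : z ∈ (C.B k).inner) (hz' : z ∈ (C.B (k + 1)).inner)
    (hin : C.sigmaIn k t z = 1) (hout : C.sigmaOut (k + 1) t z = 0) :
    C.chi k t z + C.chi (k + 1) t z = 1 ∧ ∀ j < C.K, j ≠ k → j ≠ k + 1 → C.chi j t z = 0 := by
  have hk' : k < C.K := by omega
  have hsupp : ∀ {m : ℕ}, m < C.K → z ∈ (C.B m).inner → z ∈ (C.B m).supp := by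
    intro m hm hzm
    obtain ⟨h1, h2, h3, h4⟩ := hzm
    have hρ := h.ρ_pos m hm
    exact ⟨by linarith, by linarith, by linarith, by linarith⟩
  have hzs := hsupp hk' hz
  have hzs' := hsupp hk hz'
  constructor
  · rw [chi_apply, chi_apply, (C.B k).val_eq_one (h.ρ_pos k hk') hz,
      (C.B (k + 1)).val_eq_one (h.ρ_pos _ hk) hz', hin, sigmaIn_succ, hout]
    ring
  · intro j hj hjk hjk1
    rcases Nat.lt_or_gt_of_ne hjk with hlt | hgt
    · by_cases hj1 : j + 1 = k
      · subst hj1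
        rw [sigmaIn_succ] at hin
        exact h.chi_eq_zero_of_sigmaOut_eq_one hj hin
      · exact h.chi_eq_zero_of_not_mem hj fun hzj => h.disjoint j hj k hk' (by omega) z hzj hzs
    · have hgt' : k + 1 < j := lt_of_le_of_ne (by omega) (Ne.symm hjk1)
      by_cases hj2 : k + 2 = j
      · subst hj2
        exact h.chi_succ_eq_zero hj hout
      · exact h.chi_eq_zero_of_not_mem hj fun hzj => h.disjoint (k + 1) hk j hj (by omega) z hzs' hzj

/-- **Where a cut-off does not vanish**: `χ_k(t,z) ≠ 0` forces `z` into the support box of `k`,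
a positive in-step and an out-step below `1`. [folklore] -/
theorem WF.chi_ne_zero (h : C.WF) {k : ℕ} (hk : k < C.K) {t : ℝ} {z : E²} (hne : C.chi k t z ≠ 0) :
    z ∈ (C.B k).supp ∧ 0 < C.sigmaIn k t z ∧ C.sigmaOut k t z < 1 := by
  have hzs : z ∈ (C.B k).supp := by
    by_contra hz
    exact hne (h.chi_eq_zero_of_not_mem hk hz)
  have hdiff : C.sigmaIn k t z ≠ C.sigmaOut k t z := by
    intro e; rw [chi_apply, e, sub_self, mul_zero] at hne; exact hne rfl
  refine ⟨hzs, ?_, ?_⟩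
  · rcases (C.sigmaIn_mem_Icc k t z).1.lt_or_eq with hpos | h0
    · exact hpos
    · -- in-step `0`: the order condition forces the out-step to vanish too
      exfalso
      have hout : C.sigmaOut k t z = 0 := by
        by_contra hne'
        have hpos : 0 < C.sigmaOut k t z := lt_of_le_of_ne (C.sigmaOut_mem_Icc k t z).1 (Ne.symm hne')
        have := h.order k hk t z hzs hpos
        rw [← h0] at this
        exact zero_ne_one this
      exact hdiff (h0.symm.trans hout.symm)
  · rcases (C.sigmaOut_mem_Icc k t z).2.lt_or_eq with hlt | h1
    · exact hlt
    · exfalso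
      exact hdiff ((h.order k hk t z hzs (by rw [h1]; exact one_pos)).trans h1.symm)

/-! ## The regions of a chain -/

/-- The in-step region `{σ_{k-1} = 1}` of element `k` in the strict form `arg_{k-1} > 2/3`
(all of space-time for `k = 0`). [folklore] -/
def inOne (k : ℕ) : Set (ℝ × E²) := {p | k = 0 ∨ 2 / 3 < (C.J (k - 1)).arg p.1 p.2}

/-- The out-step region `{σ_k = 0}` of element `k` in the strict form `arg_k < 1/3` (all of
space-time for the last element). [folklore] -/
def outZero (k : ℕ) : Set (ℝ × E²) := {p | k + 1 < C.K → (C.J k).arg p.1 p.2 < 1 / 3}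

/-- **Core region** of element `k`: inner box, in-step `1`, out-step `0`. [folklore] -/
def core (k : ℕ) : Set (ℝ × E²) := {p | p.2 ∈ (C.B k).inner} ∩ C.inOne k ∩ C.outZero k

/-- **Junction region** of elements `k`, `k+1` (cut-off part): both inner boxes, in-step of `k`
equal to `1`, out-step of `k+1` equal to `0`. [folklore] -/
def juncCut (k : ℕ) : Set (ℝ × E²) :=
  {p | p.2 ∈ (C.B k).inner ∧ p.2 ∈ (C.B (k + 1)).inner} ∩ C.inOne k ∩ C.outZero (k + 1)

/-- **Tube box** of element `k`: support box, in-step argument `≥ 1/3`, out-step argument `≤ 2/3`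
(a closed region containing every point where `χ_k ≠ 0`). [folklore] -/
def tubeBox (k : ℕ) : Set (ℝ × E²) :=
  {p | p.2 ∈ (C.B k).supp} ∩ {p | k = 0 ∨ 1 / 3 ≤ (C.J (k - 1)).arg p.1 p.2} ∩
    {p | k + 1 < C.K → (C.J k).arg p.1 p.2 ≤ 2 / 3}

/-- On the in-step region the in-step is `1`. [folklore] -/
theorem sigmaIn_eq_one_of_mem {k : ℕ} (hk : k < C.K) {p : ℝ × E²} (hp : p ∈ C.inOne k) :
    C.sigmaIn k p.1 p.2 = 1 := by
  rcases hp with h0 | hgt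
  · subst h0; rfl
  · unfold sigmaIn
    split_ifs with h0
    · rfl
    · unfold sigmaOut
      rw [if_pos (by omega)]
      exact (C.J (k - 1)).val_eq_one hgt.le

/-- On the out-step region the out-step is `0`. [folklore] -/
theorem sigmaOut_eq_zero_of_mem {k : ℕ} {p : ℝ × E²} (hp : p ∈ C.outZero k) : C.sigmaOut k p.1 p.2 = 0 := by
  unfold sigmaOut
  split_ifs with hk
  · exact (C.J k).val_eq_zero (hp hk).le
  · rfl

/-- The core region is open. [folklore] -/
theorem WF.isOpen_core (h : C.WF) {k : ℕ} (hk : k < C.K) : IsOpen (C.core k) := by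
  refine ((isOpen_univ_prod (C.B k).isOpen_inner).inter ?_).inter ?_
  · by_cases h0 : k = 0
    · convert isOpen_univ (X := ℝ × E²); ext p; simp [inOne, h0]
    · have hop := (C.J (k - 1)).isOpen_arg_gt (h.pos_continuous (j := k - 1) (by omega)) (2 / 3)
      convert hop using 1; ext p; simp [inOne, h0]
  · by_cases hk1 : k + 1 < C.K
    · have hop := (C.J k).isOpen_arg_lt (h.pos_continuous hk1) (1 / 3)
      convert hop using 1; ext p; simp [outZero, hk1]
    · convert isOpen_univ (X := ℝ × E²); ext p; simp [outZero, hk1]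

/-- The junction region (cut-off part) is open. [folklore] -/
theorem WF.isOpen_juncCut (h : C.WF) {k : ℕ} (hk : k + 1 < C.K) : IsOpen (C.juncCut k) := by
  refine ((isOpen_univ_prod ((C.B k).isOpen_inner.inter (C.B (k + 1)).isOpen_inner)).inter ?_).inter ?_
  · by_cases h0 : k = 0
    · convert isOpen_univ (X := ℝ × E²); ext p; simp [inOne, h0]
    · have hop := (C.J (k - 1)).isOpen_arg_gt (h.pos_continuous (j := k - 1) (by omega)) (2 / 3)
      convert hop using 1; ext p; simp [inOne, h0]
  · by_cases hk2 : k + 2 < C.K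
    · have hop := (C.J (k + 1)).isOpen_arg_lt (h.pos_continuous hk2) (1 / 3)
      convert hop using 1; ext p; simp [outZero, hk2]
    · convert isOpen_univ (X := ℝ × E²); ext p; simp [outZero, hk2]

/-- The tube box is closed. [folklore] -/
theorem WF.isClosed_tubeBox (h : C.WF) {k : ℕ} (hk : k < C.K) : IsClosed (C.tubeBox k) := by
  refine ((isClosed_univ_prod (C.B k).isClosed_supp).inter ?_).inter ?_
  · by_cases h0 : k = 0
    · convert isClosed_univ (X := ℝ × E²); ext p; simp [h0]
    · have hcl := (C.J (k - 1)).isClosed_arg_ge (h.pos_continuous (j := k - 1) (by omega)) (1 / 3)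
      convert hcl using 1; ext p; simp [h0]
  · by_cases hk1 : k + 1 < C.K
    · have hcl := (C.J k).isClosed_arg_le (h.pos_continuous hk1) (2 / 3)
      convert hcl using 1; ext p; simp [hk1]
    · convert isClosed_univ (X := ℝ × E²); ext p; simp [hk1]

/-- **`χ_k ≠ 0` only on the tube box.** [folklore] -/
theorem WF.mem_tubeBox_of_chi_ne_zero (h : C.WF) {k : ℕ} (hk : k < C.K) {p : ℝ × E²}
    (hne : C.chi k p.1 p.2 ≠ 0) : p ∈ C.tubeBox k := by
  obtain ⟨hzs, hin, hout⟩ := h.chi_ne_zero hk hne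
  refine ⟨⟨hzs, ?_⟩, fun hk1 => ?_⟩
  · by_cases h0 : k = 0
    · exact Or.inl h0
    · right
      unfold sigmaIn at hin
      rw [if_neg h0] at hin
      unfold sigmaOut at hin
      rw [if_pos (by omega)] at hin
      exact ((C.J (k - 1)).arg_gt_of_val_pos hin).le
  · unfold sigmaOut at hout
    rw [if_pos hk1] at hout
    exact ((C.J k).arg_lt_of_val_lt_one hout).le

/-! ## Region data from a chain -/

/-- **Region data from a well-formed chain.** Given, besides the chain, for each junction an OPEN
agreement region on which the consecutive elements coincide, for each element a CLOSED band
containing (within the tube box) the support of `χ_k Θ_k`, and the cover of the tubes over `S × Q`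
by cores and junctions, the families `(χ, Θ, H)` carry region data with
`Core k = core k`, `Junc k = juncCut k ∩ Agree k`, `Tube k = tubeBox k ∩ Band k`. [folklore] -/
theorem WF.isRegionData (h : C.WF) {Θ H : ℕ → ℝ → E² → ℝ} {Agree Band : ℕ → Set (ℝ × E²)}
    {S : Set ℝ} {Q : Set E²}
    (hAo : ∀ k, k + 1 < C.K → IsOpen (Agree k))
    (hAΘ : ∀ k, k + 1 < C.K → ∀ p ∈ Agree k, Θ (k + 1) p.1 p.2 = Θ k p.1 p.2)
    (hAH : ∀ k, k + 1 < C.K → ∀ p ∈ Agree k, H (k + 1) p.1 p.2 = H k p.1 p.2)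
    (hBc : ∀ k < C.K, IsClosed (Band k))
    (hBΘ : ∀ k < C.K, ∀ p : ℝ × E², p ∈ C.tubeBox k → Θ k p.1 p.2 ≠ 0 → p ∈ Band k)
    (hcover : ∀ t ∈ S, ∀ z ∈ Q, ∀ k < C.K, (t, z) ∈ C.tubeBox k ∩ Band k →
      (t, z) ∈ C.core k ∨ (0 < k ∧ (t, z) ∈ C.juncCut (k - 1) ∩ Agree (k - 1)) ∨
        (k + 1 < C.K ∧ (t, z) ∈ C.juncCut k ∩ Agree k)) :
    IsRegionData C.K C.chi Θ H C.core (fun k => C.juncCut k ∩ Agree k) (fun k => C.tubeBox k ∩ Band k) S Q where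
  isOpen_core k hk := h.isOpen_core hk
  isOpen_junc k hk := (h.isOpen_juncCut hk).inter (hAo k hk)
  isClosed_tube j hj := (h.isClosed_tubeBox hj).inter (hBc j hj)
  core_one k hk p hp :=
    (h.chi_core hk hp.1.1 (C.sigmaIn_eq_one_of_mem hk hp.1.2) (C.sigmaOut_eq_zero_of_mem hp.2)).1
  core_zero k hk p hp j hj hjk :=
    (h.chi_core hk hp.1.1 (C.sigmaIn_eq_one_of_mem hk hp.1.2) (C.sigmaOut_eq_zero_of_mem hp.2)).2 j hj hjk
  junc_sum k hk p hp :=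
    (h.chi_junction hk hp.1.1.1.1 hp.1.1.1.2 (C.sigmaIn_eq_one_of_mem (by omega) hp.1.1.2)
      (C.sigmaOut_eq_zero_of_mem hp.1.2)).1
  junc_zero k hk p hp j hj hjk hjk1 :=
    (h.chi_junction hk hp.1.1.1.1 hp.1.1.1.2 (C.sigmaIn_eq_one_of_mem (by omega) hp.1.1.2)
      (C.sigmaOut_eq_zero_of_mem hp.1.2)).2 j hj hjk hjk1
  junc_scalar k hk p hp := hAΘ k hk p hp.2
  junc_stream k hk p hp := hAH k hk p hp.2
  tube j hj p hne := by
    have hχ : C.chi j p.1 p.2 ≠ 0 := fun e => hne (by rw [e, zero_mul])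
    have hΘ : Θ j p.1 p.2 ≠ 0 := fun e => hne (by rw [e, mul_zero])
    have hmem := h.mem_tubeBox_of_chi_ne_zero hj hχ
    exact ⟨hmem, hBΘ j hj p hmem hΘ⟩
  cover t ht z hz hex := by
    obtain ⟨j, hj, hmem⟩ := hex
    rcases hcover t ht z hz j hj hmem with hc | ⟨hj0, hju⟩ | ⟨hj1, hju⟩
    · exact Or.inl ⟨j, hj, hc⟩
    · exact Or.inr ⟨j - 1, by omega, by
        have e : j - 1 + 1 = j := by omega
        simpa only using hju⟩
    · exact Or.inr ⟨j, hj1, hju⟩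

end ChainData

end PlanarKinematics

end Literature.Analysis.FluidPDE
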